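import Literature.AlgebraicGeometry.Morphisms.ReducedInducedPiece
import Literature.AlgebraicGeometry.Motives.ProjBasicOpenSubscheme
import Mathlib.AlgebraicGeometry.Morphisms.ClosedImmersion
import HarnessLib

/-!
# A reduced affine scheme closed in `D₊(x) ⊆ Proj A` with support `Z ∩ D₊(x)` is the chart of `Z_red` over `D₊(x)`

Topic `Literature/AlgebraicGeometry/Motives` (next to `ProjBasicOpenSubscheme`). Theorems only; no named fact. Written by the
prover seat `hodge-nonav-19716-p2` (g13, cell `hodge-nonav`) for brick **M1-1 «CHART-IN-COVER»** of prover-Bx's programme M1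
(memo `PROGRAMME-M1-Bx-g19.md` §2; route `HodgeConjecture/Q8SymplecticPowers`, crux K1Q, stmt-HodgeConjecture-24190): the
`Proj`-chart form of `Morphisms.exists_isOpenImmersion_of_isClosedImmersion_of_range_eq` — the shape in which the explicit étale
deck chart `Spec (deckRing) ↠ Spec (A[x]_{(x₂ h̃)})₀ = D₊(x₂ h̃) ⊆ ℙ³_A` is put inside the reduced cover `Q8Family.cover e`.

For a graded ring `A` (Mathlib `Proj 𝒜`), a closed subset `Z ⊆ Proj A` with reduced induced subscheme `Z_red = V(𝓘_Z) ↪ Proj A`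
(`IdealSheafData.vanishingIdeal`, Hartshorne II Example 3.2.6) and a homogeneous `x` of positive degree:

* `range_specMap_comp_awayι` — for a ring map `θ : A_{(x)} → B`, the image of `Spec B → Spec A_{(x)} → Proj A` is
  `awayι(range (Spec θ))`;
* **`exists_isOpenImmersion_subscheme_of_surjective`** — if `θ` is SURJECTIVE, `B` is reduced and the image of `Spec θ` is
  `awayι⁻¹(Z)` (i.e. the closed subscheme `Spec B ↪ Spec A_{(x)} = D₊(x)` has support `Z ∩ D₊(x)`), then there is an open immersion
  `f : Spec B ⟶ Z_red` with `f ≫ (Z_red ↪ Proj A) = Spec θ ≫ awayι` and image `(Z_red ↪ Proj A)⁻¹ D₊(x)` (Hartshorne II Prop. 2.5 (b),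
  Example 3.2.6).

## References

* [Hartshorne1977] R. Hartshorne, Algebraic Geometry (1977): II Prop. 2.5 (b) (`D₊(x) ≅ Spec A_{(x)}`), II Example 3.2.6.
* [GortzWedhorn2020] U. Görtz, T. Wedhorn, Algebraic Geometry I, 2nd ed. (2020), Prop. 3.52.
-/

noncomputable section

set_option backward.isDefEq.respectTransparency false

open CategoryTheory AlgebraicGeometry TopologicalSpace HomogeneousLocalization

universe u

namespace Literature.AlgebraicGeometry.Motives.ProjSubscheme

variable {R A : Type u} [CommRing R] [CommRing A] [Algebra R A] (𝒜 : ℕ → Submodule R A) [GradedAlgebra 𝒜]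
variable {m : ℕ} {x : A} (x_deg : x ∈ 𝒜 m) (hm : 0 < m)

/-- The image of `Spec B → Spec A_{(x)} → Proj A` is `awayι` of the image of `Spec B → Spec A_{(x)}`. [cite: Hartshorne1977, II Prop. 2.5 (b)] -/
theorem range_specMap_comp_awayι {B : Type u} [CommRing B] (θ : Away 𝒜 x →+* B) :
    Set.range (Spec.map (CommRingCat.ofHom θ) ≫ Proj.awayι 𝒜 x x_deg hm) =
      Proj.awayι 𝒜 x x_deg hm '' Set.range (Spec.map (CommRingCat.ofHom θ)) := by
  rw [Scheme.Hom.comp_base, TopCat.coe_comp, Set.range_comp]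

/-- **The chart of `Z_red` over `D₊(x)` from a reduced quotient of `A_{(x)}` with the right support.** Let `θ : A_{(x)} ↠ B` be
surjective with `B` reduced, and suppose the image of `Spec B ↪ Spec A_{(x)}` is `awayι⁻¹(Z)`. Then `Spec B` is the piece of the
reduced induced subscheme `Z_red` over `D₊(x)`: there is an open immersion `f : Spec B ⟶ Z_red` with
`f ≫ (Z_red ↪ Proj A) = Spec θ ≫ awayι` whose image is the preimage of `D₊(x)`. [cite: Hartshorne1977, II Example 3.2.6]
[cite: GortzWedhorn2020, Prop. 3.52] -/
theorem exists_isOpenImmersion_subscheme_of_surjective (Z : Closeds (Proj 𝒜)) {B : Type u} [CommRing B] [IsReduced B]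
    (θ : Away 𝒜 x →+* B) (hθ : Function.Surjective θ)
    (hrange : Set.range (Spec.map (CommRingCat.ofHom θ)) = Proj.awayι 𝒜 x x_deg hm ⁻¹' (Z : Set (Proj 𝒜))) :
    ∃ (f : Spec (.of B) ⟶ (Scheme.IdealSheafData.vanishingIdeal Z).subscheme) (_ : IsOpenImmersion f),
      f ≫ (Scheme.IdealSheafData.vanishingIdeal Z).subschemeι = Spec.map (CommRingCat.ofHom θ) ≫ Proj.awayι 𝒜 x x_deg hm ∧
      f.opensRange = (Scheme.IdealSheafData.vanishingIdeal Z).subschemeι ⁻¹ᵁ Proj.basicOpen 𝒜 x := by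
  -- `g : Spec B ⟶ D₊(x)`, a closed immersion (Spec of a surjection, then `Spec A_{(x)} ≅ D₊(x)`)
  let g : Spec (.of B) ⟶ ↑(Proj.basicOpen 𝒜 x) :=
    Spec.map (CommRingCat.ofHom θ) ≫ (Proj.basicOpenIsoSpec 𝒜 x x_deg hm).inv
  haveI : IsClosedImmersion (Spec.map (CommRingCat.ofHom θ)) := IsClosedImmersion.spec_of_surjective _ hθ
  haveI : IsClosedImmersion g := inferInstance
  have hg : g ≫ (Proj.basicOpen 𝒜 x).ι = Spec.map (CommRingCat.ofHom θ) ≫ Proj.awayι 𝒜 x x_deg hm := by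
    rw [Category.assoc, Proj.basicOpenIsoSpec_inv_ι]
  have hrange' : Set.range (g ≫ (Proj.basicOpen 𝒜 x).ι) = (Z : Set (Proj 𝒜)) ∩ Proj.basicOpen 𝒜 x := by
    rw [hg, range_specMap_comp_awayι 𝒜 x_deg hm θ, hrange, Set.image_preimage_eq_inter_range,
      ← Scheme.Hom.coe_opensRange, Proj.opensRange_awayι]
  obtain ⟨f, hf, hfac, hran⟩ :=
    Morphisms.exists_isOpenImmersion_of_isClosedImmersion_of_range_eq Z (Proj.basicOpen 𝒜 x) g hrange'
  exact ⟨f, hf, hfac.trans hg, hran⟩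

end Literature.AlgebraicGeometry.Motives.ProjSubscheme

end
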